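import Literature.Geometry.Manifold.DeRhamProductInduction
import Literature.Geometry.Manifold.DeRhamProductDefectExact
import Literature.Geometry.Manifold.DeRhamComparisonTheta
import Literature.Geometry.Manifold.SphereDetection
import Literature.AlgebraicTopology.SingularHomology.LerayHirschTransport
import HarnessLib

/-!
# Multiplicativity of the de Rham comparison for external products: the test manifolds

Continuing `DeRhamProductDefect.lean` … `DeRhamProductInduction.lean`: we prove that the two sides
`lhs` (`Ψ'[π₁^* η ∧ π₂^* β]`) and `rhs` (`π₁^* Ψ'[η] ⌣ π₂^♯ b_β`) agree on `(M₁, univ)` in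
form-degree `k` for the following TEST MANIFOLDS `M₁` (first factor):

* `lhs_eq_rhs_of_isZero_homology`: when `Hₖ(M₁; ℝ) = 0` (then `Hᵏ(Ω•(M₁)) = 0`);
* `lhs_eq_rhs_of_detect`: when `Hₖ(M₁; ℝ)` is finite-dimensional and every non-zero class of it is
  detected by a smooth map `M₁ → ℝᵏ⁺¹ ∖ {0}` (the handlebody of the `k`-handles of a compact
  manifold, `MorseHandlebodies`, `SphereDetection`). Proof: Kronecker duality — the classes
  `a ∈ Hᵏ(Ω•(M₁))` with `lhs a = rhs a` contain all pull-backs of classes of `(ℝᵏ⁺¹, ℝᵏ⁺¹ ∖ {0})`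
  (naturality under maps of pairs and the agreement on coordinate open sets of a vector space,
  `agree_coordQ`), and those pull-backs pair non-trivially with every non-zero homology class;

and we record the two TRANSFER statements used by the product-rigidity argument:

* `resH_lhs_eq_resH_rhs_of_opens`: if the two sides agree on `(↥U, univ)` for an open `U ⊆ M`,
  then the restrictions to `π₁⁻¹ U` of the two sides on `(M, univ)` agree (naturality under the
  map of pairs `↥U → (M, U)` and injectivity of `(val × id)^*`, an embedding);
* `pullH_lhs_eq_pullH_rhs_of_opens_snd`: if `Hˡ(Ω•(↥V)) = 0` for an open `V ⊆ N`, the pull-backs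
  along `id × val : M × ↥V → M × N` of the two sides agree (`β|_V` is exact,
  `DeRhamProductDefectExact`).

Everything is proved; no named facts.

## References

* [Bredon1993] G. E. Bredon, *Topology and Geometry*, GTM 139 (1993), §V.9 Thm. V.9.5, §VI.4.
* [HatcherAT2002] A. Hatcher, *Algebraic Topology*, CUP 2002, §3.1 Thm. 3.2, §3.2 Prop. 3.10.
* [MilnorHCobordism1965] J. Milnor, *Lectures on the h-cobordism theorem* (1965), Thm. 7.6.
-/

noncomputable section

-- see "Implementation notes" in `…SingularHomology.SingularChainsConcrete`
set_option backward.isDefEq.respectTransparency false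

open scoped Manifold ContDiff Topology
open CategoryTheory Limits Set Function Literature.AlgebraicTopology.SingularHomology Literature.Geometry.Kaehler

namespace Literature.Geometry.Manifold

/-! ### Cohomology from homology over a field -/

/-- `Hᵏ(X; F) = 0` if `Hₖ(X; F) = 0` (Kronecker duality over a field). [cite: HatcherAT2002, §3.1 Thm. 3.2] -/
theorem subsingleton_singularCohomology_of_isZero (F : Type) [Field F] (X : Type) [TopologicalSpace X] (k : ℕ)
    (h : IsZero (singularHomology F F X k)) : Subsingleton (singularCohomology F F X k) := by
  haveI := ModuleCat.subsingleton_of_isZero h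
  refine ⟨fun a b ↦ (kroneckerPairing_bijective_of_field F X k).1 ?_⟩
  ext σ
  rw [Subsingleton.elim σ 0, map_zero, map_zero]

/-- `Hᵏ(X; F)` is finite-dimensional if `Hₖ(X; F)` is (Kronecker duality over a field).
[cite: HatcherAT2002, §3.1 Thm. 3.2] -/
theorem finite_singularCohomology_of_finite (F : Type) [Field F] (X : Type) [TopologicalSpace X] (k : ℕ)
    [Module.Finite F (singularHomology F F X k)] : Module.Finite F (singularCohomology F F X k) :=
  Module.Finite.of_injective (kroneckerPairing F F X k) (kroneckerPairing_bijective_of_field F X k).1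

/-! ### Test manifolds with vanishing homology -/

section Vanishing

universe u

variable {E : Type u} [NormedAddCommGroup E] [NormedSpace ℝ E] {H : Type u} [TopologicalSpace H]
  {I : ModelWithCorners ℝ E H} {M : Type u} [TopologicalSpace M] [ChartedSpace H M]
  [IsManifold I ∞ M] [I.Boundaryless] [FiniteDimensional ℝ E] [T2Space M] [SecondCountableTopology M]
  [LocallyCompactSpace M]
  {E' : Type u} [NormedAddCommGroup E'] [NormedSpace ℝ E'] {H' : Type u} [TopologicalSpace H']
  {I' : ModelWithCorners ℝ E' H'} {N : Type u} [TopologicalSpace N] [ChartedSpace H' N] [IsManifold I' ∞ N]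
  [I'.Boundaryless] [FiniteDimensional ℝ E'] [T2Space N] [SecondCountableTopology N] [LocallyCompactSpace N]
  {k l n : ℕ}

/-- **`Hᵏ(Ω•(M)) = 0` when `Hᵏ(M; ℝ) = 0`** (through the de Rham comparison isomorphism).
[cite: Bredon1993, Thm. V.9.5] -/
theorem localDeRham_class_eq_zero_of_subsingleton [Subsingleton (singularCohomology ℝ ℝ M k)]
    (x : (localDeRhamComplex I ℝ (isOpen_univ : IsOpen (univ : Set M))).homology k) : x = 0 :=
  (deRhamComparisonIso I M k).toLinearEquiv.injective (Subsingleton.elim _ _)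

/-- **The two sides agree on `(M, univ)` in form-degree `k` when `Hᵏ(M; ℝ) = 0`** (the source is
zero). [cite: Bredon1993, Thm. V.9.5] -/
theorem lhs_eq_rhs_of_subsingleton [Subsingleton (singularCohomology ℝ ℝ M k)] (β : closedSmoothForms I' N ℝ l)
    (h : k + l = n) (a : (localDeRhamComplex I ℝ (isOpen_univ : IsOpen (univ : Set M))).homology k) :
    lhs N isOpen_univ β k n h a = rhs N isOpen_univ β k n h a := by
  rw [localDeRham_class_eq_zero_of_subsingleton (I := I) a, map_zero, map_zero]

/-- **The two sides agree for a second factor with `Hˡ(N; ℝ) = 0`** (then `[β] = 0` and both sides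
vanish, `DeRhamProductDefectExact`). [cite: Bredon1993, Thm. V.9.5] -/
theorem lhs_eq_rhs_of_subsingleton_snd [Subsingleton (singularCohomology ℝ ℝ N l)] {W : Set M} (hW : IsOpen W)
    (β : closedSmoothForms I' N ℝ l) (h : k + l = n) (a : (localDeRhamComplex I ℝ hW).homology k) :
    lhs N hW β k n h a = rhs N hW β k n h a := by
  have hb : closedToLocalHomology I' N ℝ l β = 0 := localDeRham_class_eq_zero_of_subsingleton (I := I') _
  rw [lhs_eq_zero_of_closedToLocalHomology_eq_zero hW β hb, rhs_eq_zero_of_closedToLocalHomology_eq_zero hW β hb]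

end Vanishing

/-! ### Test manifolds detected by maps to the punctured Euclidean space -/

section Detect

variable {E₁ : Type} [NormedAddCommGroup E₁] [NormedSpace ℝ E₁] [FiniteDimensional ℝ E₁]
  {M₁ : Type} [TopologicalSpace M₁] [ChartedSpace E₁ M₁] [IsManifold 𝓘(ℝ, E₁) ∞ M₁] [T2Space M₁]
  [SecondCountableTopology M₁] [LocallyCompactSpace M₁]
  {E' : Type} [NormedAddCommGroup E'] [NormedSpace ℝ E'] {H' : Type} [TopologicalSpace H']
  {I' : ModelWithCorners ℝ E' H'} {N : Type} [TopologicalSpace N] [ChartedSpace H' N] [IsManifold I' ∞ N]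
  [I'.Boundaryless] [FiniteDimensional ℝ E'] [T2Space N] [SecondCountableTopology N] [LocallyCompactSpace N]
  {k l n : ℕ}

/-- The punctured Euclidean space is open. [folklore] -/
theorem isOpen_puncturedSet (m : ℕ) : IsOpen (puncturedSet m) :=
  isOpen_ne_fun continuous_id continuous_const

/-- The punctured Euclidean space is the top coordinate open set `Q (k + 1)` of `ℝᵏ⁺¹`. [folklore] -/
theorem coordQ_equiv_eq_puncturedSet (m : ℕ) :
    coordQ (EuclideanSpace.equiv (Fin m) ℝ) m = puncturedSet m := by
  ext x
  simp only [coordQ, mem_setOf_eq, puncturedSet]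
  constructor
  · rintro ⟨j, -, hj⟩ h0
    apply hj
    rw [h0, map_zero]
    rfl
  · intro hx
    by_contra hall
    simp only [not_exists, not_and, not_not] at hall
    apply hx
    have h0 : (EuclideanSpace.equiv (Fin m) ℝ) x = 0 := funext fun j ↦ hall j j.isLt
    exact (EuclideanSpace.equiv (Fin m) ℝ).injective (h0.trans (map_zero _).symm)

/-- **The two sides agree on the punctured Euclidean space** `(ℝᵐ, ℝᵐ ∖ {0})` (it is the top
coordinate open set, `agree_coordQ`). [cite: Bredon1993, Thm. V.9.5] -/
theorem lhs_eq_rhs_puncturedSet (m : ℕ) (β : closedSmoothForms I' N ℝ l) {k n : ℕ} (h : k + l = n)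
    (c : (localDeRhamComplex 𝓘(ℝ, EuclideanSpace ℝ (Fin m)) ℝ (isOpen_puncturedSet m)).homology k) :
    lhs N (isOpen_puncturedSet m) β k n h c = rhs N (isOpen_puncturedSet m) β k n h c :=
  agree_congr_set β (coordQ_equiv_eq_puncturedSet m) _ (isOpen_puncturedSet m)
    (agree_coordQ (EuclideanSpace.equiv (Fin m) ℝ) β m le_rfl) k n h c

/-- **The two sides agree on `(M₁, univ)` in form-degree `k` for a test manifold `M₁` whose
degree-`k` homology is finite-dimensional and detected by smooth maps to `ℝᵏ⁺¹ ∖ {0}`.**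
Kronecker duality: the image in `Hᵏ(M₁; ℝ)` of `{a | lhs a = rhs a}` contains the pull-backs
`G^* v` of all classes of `ℝᵏ⁺¹ ∖ {0}` along all such maps `G` (naturality of both sides under the
map of pairs `G : (M₁, univ) → (ℝᵏ⁺¹, ℝᵏ⁺¹ ∖ {0})` and `lhs_eq_rhs_puncturedSet`), and a homology
class killed by all of these is zero (detection), so the image is everything.
[cite: Bredon1993, Thm. V.9.5] [cite: HatcherAT2002, §3.1 Thm. 3.2] [cite: MilnorHCobordism1965, Thm. 7.6] -/
theorem lhs_eq_rhs_of_detect [Module.Finite ℝ (singularHomology ℝ ℝ M₁ k)]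
    (hdet : ∀ σ : singularHomology ℝ ℝ M₁ k, σ ≠ 0 →
      ∃ (G : M₁ → EuclideanSpace ℝ (Fin (k + 1))) (hG : ContMDiff 𝓘(ℝ, E₁) 𝓘(ℝ, EuclideanSpace ℝ (Fin (k + 1))) ∞ G)
        (hG0 : ∀ u, G u ∈ puncturedSet (k + 1)),
        singularHomology.map ℝ ℝ
          (⟨fun u ↦ ⟨G u, hG0 u⟩, hG.continuous.subtype_mk _⟩ : C(M₁, ↥(puncturedSet (k + 1)))) k σ ≠ 0)
    (β : closedSmoothForms I' N ℝ l) (h : k + l = n)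
    (a : (localDeRhamComplex 𝓘(ℝ, E₁) ℝ (isOpen_univ : IsOpen (univ : Set M₁))).homology k) :
    lhs N isOpen_univ β k n h a = rhs N isOpen_univ β k n h a := by
  haveI : SigmaCompactSpace M₁ := sigmaCompactSpace_of_locallyCompact_secondCountable
  set Q : Set (EuclideanSpace ℝ (Fin (k + 1))) := puncturedSet (k + 1) with hQdef
  have hQ : IsOpen Q := isOpen_puncturedSet (k + 1)
  -- the comparison `Hᵏ(Ω•(M₁)) ≅ Hᵏ(M₁; ℝ)` and the good subspace
  let cmp : (localDeRhamComplex 𝓘(ℝ, E₁) ℝ (isOpen_univ : IsOpen (univ : Set M₁))).homology k →ₗ[ℝ]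
      singularCohomology ℝ ℝ M₁ k := ModuleCat.Hom.hom (deRhamComparisonIso 𝓘(ℝ, E₁) M₁ k).hom
  have hcmp : Injective cmp := (deRhamComparisonIso 𝓘(ℝ, E₁) M₁ k).toLinearEquiv.injective
  let D : (localDeRhamComplex 𝓘(ℝ, E₁) ℝ (isOpen_univ : IsOpen (univ : Set M₁))).homology k →ₗ[ℝ]
      (subsetCochains ℝ realCoeff.{0} (Prod.fst ⁻¹' (univ : Set M₁) : Set (M₁ × N))).homology n :=
    lhs N isOpen_univ β k n h - rhs N isOpen_univ β k n h
  let S : Submodule ℝ (singularCohomology ℝ ℝ M₁ k) := (LinearMap.ker D).map cmp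
  -- ### the good subspace is everything
  have hS : S = ⊤ := by
    refine submodule_eq_top_of_kroneckerPairing ℝ k S fun σ hσ ↦ ?_
    by_contra hσ0
    obtain ⟨G, hG, hG0, hne⟩ := hdet σ hσ0
    obtain ⟨v, hv⟩ := exists_kroneckerPairing_ne_zero ℝ k hne
    rw [← kroneckerPairing_map] at hv
    apply hv
    apply hσ
    -- `G^* v ∈ S`: write `v` as the comparison of a de Rham class of `(ℝᵏ⁺¹, Q)`
    obtain ⟨y, hy⟩ := (subsetCochains.homologyIsoSingularCohomology ℝ Q k).toLinearEquiv.surjective v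
    obtain ⟨c, rfl⟩ := (localDeRhamToSubset_bijective (I := 𝓘(ℝ, EuclideanSpace ℝ (Fin (k + 1)))) hQ k).2 y
    have hmaps : MapsTo G (univ : Set M₁) Q := fun u _ ↦ hG0 u
    refine ⟨HomologicalComplex.homologyMap (localDeRhamComplex.pullbackPair 𝓘(ℝ, E₁) hG isOpen_univ hQ hmaps) k c,
      ?_, ?_⟩
    · -- both sides are natural under the map of pairs `G`, and agree on `(ℝᵏ⁺¹, Q)`
      rw [SetLike.mem_coe, LinearMap.mem_ker]
      change lhs N isOpen_univ β k n h _ - rhs N isOpen_univ β k n h _ = 0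
      rw [lhs_pullbackPair hG isOpen_univ hQ hmaps β h c, rhs_pullbackPair hG isOpen_univ hQ hmaps β h c,
        lhs_eq_rhs_puncturedSet (k + 1) β h c, sub_self]
    · -- `cmp (G^* c) = G^* v`: compare in `Hᵏ_{M₁}(univ)` through `Θ⁻¹`
      apply thetaInv_injective
      rw [thetaInv_deRhamComparisonIso, localDeRhamToSubset_pullbackPair_apply]
      apply (subsetCochains.homologyIsoSingularCohomology ℝ (univ : Set M₁) k).toLinearEquiv.injective
      change (subsetCochains.homologyIsoSingularCohomology ℝ (univ : Set M₁) k).hom _ =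
        (subsetCochains.homologyIsoSingularCohomology ℝ (univ : Set M₁) k).hom _
      rw [subsetCochains.homologyIsoSingularCohomology_hom_pullH, subsetCochains.homologyIsoSingularCohomology_hom_thetaInv]
      have hy' : (subsetCochains.homologyIsoSingularCohomology ℝ Q k).hom
          (localDeRhamToSubset 𝓘(ℝ, EuclideanSpace ℝ (Fin (k + 1))) hQ k c) = v := hy
      rw [hy', ← ModuleCat.comp_apply, ← singularCohomology.map_comp]
      rfl
  -- ### conclusion
  have ha : cmp a ∈ S := hS ▸ Submodule.mem_top
  obtain ⟨a', ha', hcmpa⟩ := ha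
  obtain rfl : a' = a := hcmp hcmpa
  rw [SetLike.mem_coe, LinearMap.mem_ker] at ha'
  exact sub_eq_zero.1 ha'

end Detect

/-! ### Transfer: from `(↥U, univ)` to the restriction to `π₁⁻¹ U` on `(M, univ)` -/

section Transfer

universe u

variable {E : Type u} [NormedAddCommGroup E] [NormedSpace ℝ E] {H : Type u} [TopologicalSpace H]
  {I : ModelWithCorners ℝ E H} {M : Type u} [TopologicalSpace M] [ChartedSpace H M]
  [IsManifold I ∞ M] [I.Boundaryless] [FiniteDimensional ℝ E] [T2Space M] [SecondCountableTopology M]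
  [LocallyCompactSpace M]
  {E' : Type u} [NormedAddCommGroup E'] [NormedSpace ℝ E'] {H' : Type u} [TopologicalSpace H']
  {I' : ModelWithCorners ℝ E' H'} {N : Type u} [TopologicalSpace N] [ChartedSpace H' N] [IsManifold I' ∞ N]
  [I'.Boundaryless] [FiniteDimensional ℝ E'] [T2Space N] [SecondCountableTopology N] [LocallyCompactSpace N]
  {k l n : ℕ}

/-- **Transfer from the subtype to the pair**: if the two sides agree on `(↥U, univ)` for an open
`U ⊆ M` (as a manifold in its own right), then the restrictions to `π₁⁻¹ U` of the two sides on
`(M, univ)` agree: restriction is the side on `(M, U)` (`lhs_res`), the map of pairs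
`val : (↥U, univ) → (M, U)` carries it to the side on `(↥U, univ)` (`lhs_pullbackPair`), and
`(val × id)^*` is injective on `H_{M × N}(π₁⁻¹ U)` (an embedding onto it).
[cite: Bredon1993, Thm. V.9.5] [cite: HatcherAT2002, §2.1 p. 111] -/
theorem resH_lhs_eq_resH_rhs_of_opens (U : TopologicalSpace.Opens M) (β : closedSmoothForms I' N ℝ l)
    (h : k + l = n)
    (hU : haveI : LocallyCompactSpace ↥U := U.isOpen.locallyCompactSpace
      ∀ a' : (localDeRhamComplex I ℝ (isOpen_univ : IsOpen (univ : Set ↥U))).homology k,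
        lhs N isOpen_univ β k n h a' = rhs N isOpen_univ β k n h a')
    (a : (localDeRhamComplex I ℝ (isOpen_univ : IsOpen (univ : Set M))).homology k) :
    subsetCochains.resH (N := realCoeff.{u}) (preimage_mono (subset_univ (U : Set M))) n (lhs N isOpen_univ β k n h a) =
      subsetCochains.resH (N := realCoeff.{u}) (preimage_mono (subset_univ (U : Set M))) n (rhs N isOpen_univ β k n h a) := by
  haveI : LocallyCompactSpace ↥U := U.isOpen.locallyCompactSpace
  -- restriction = the sides on `(M, U)`
  rw [← lhs_res U.isOpen isOpen_univ (subset_univ _) β h a, ← rhs_res U.isOpen isOpen_univ (subset_univ _) β h a]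
  set a'' := HomologicalComplex.homologyMap (localDeRhamComplex.res I ℝ U.isOpen isOpen_univ (subset_univ _)) k a
  -- the map of pairs `val : (↥U, univ) → (M, U)`
  have hval : ContMDiff I I ∞ (Subtype.val : ↥U → M) := contMDiff_subtype_val
  have hmaps : MapsTo (Subtype.val : ↥U → M) (univ : Set ↥U) (U : Set M) := fun x _ ↦ x.2
  have key : subsetCochains.pullH (N := realCoeff.{u}) (prodMapIdCM (N := N) hval) (mapsTo_prodMap_id hmaps) n
      (lhs N U.isOpen β k n h a'') =
      subsetCochains.pullH (N := realCoeff.{u}) (prodMapIdCM (N := N) hval) (mapsTo_prodMap_id hmaps) n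
        (rhs N U.isOpen β k n h a'') := by
    rw [← lhs_pullbackPair hval isOpen_univ U.isOpen hmaps β h a'', ← rhs_pullbackPair hval isOpen_univ U.isOpen hmaps β h a'']
    exact hU _
  -- `(val × id)^*` to `π₁⁻¹ univ` = restriction ∘ `(val × id)^*` to the preimage, both injective
  have hemb : Topology.IsEmbedding (prodMapIdCM (N := N) hval) :=
    Topology.IsEmbedding.subtypeVal.prodMap Topology.IsEmbedding.id
  have hrange : (Prod.fst ⁻¹' (U : Set M) : Set (M × N)) ⊆ range (prodMapIdCM (N := N) hval) := by
    rintro ⟨x, y⟩ hx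
    exact ⟨(⟨x, hx⟩, y), rfl⟩
  have hbij := subsetCochains.pullH_bijective_of_isEmbedding ℝ realCoeff.{u} (prodMapIdCM (N := N) hval) hemb hrange n
  have hsub : (Prod.fst ⁻¹' (univ : Set ↥U) : Set (↥U × N)) ⊆ (prodMapIdCM (N := N) hval) ⁻¹' (Prod.fst ⁻¹' (U : Set M)) :=
    fun p _ ↦ p.1.2
  have hsub' : (prodMapIdCM (N := N) hval) ⁻¹' (Prod.fst ⁻¹' (U : Set M)) ⊆ (Prod.fst ⁻¹' (univ : Set ↥U) : Set (↥U × N)) :=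
    fun _ _ ↦ mem_univ _
  have hfac : ∀ z, subsetCochains.pullH (N := realCoeff.{u}) (prodMapIdCM (N := N) hval) (mapsTo_prodMap_id hmaps) n z =
      subsetCochains.resH (N := realCoeff.{u}) hsub n
        (subsetCochains.pullH (N := realCoeff.{u}) (prodMapIdCM (N := N) hval)
          (subsetCochains.mapsTo_preimage_left (prodMapIdCM (N := N) hval) (Prod.fst ⁻¹' (U : Set M))) n z) := by
    intro z
    have := subsetCochains.resH_comp_pullH (R := ℝ) (N := realCoeff.{u}) (prodMapIdCM (N := N) hval) hsub
      (subset_refl (Prod.fst ⁻¹' (U : Set M)))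
      (subsetCochains.mapsTo_preimage_left (prodMapIdCM (N := N) hval) (Prod.fst ⁻¹' (U : Set M))) (mapsTo_prodMap_id hmaps) n
    have e := congrArg (fun φ ↦ (ModuleCat.Hom.hom φ) z) this
    simp only [ModuleCat.hom_comp, LinearMap.comp_apply] at e
    rw [subsetCochains.resH_refl_apply] at e
    exact e
  have hinj_res : Injective (subsetCochains.resH (N := realCoeff.{u}) hsub n) := by
    intro z z' hzz'
    have := congrArg (subsetCochains.resH (N := realCoeff.{u}) hsub' n) hzz'
    have hrr : ∀ w, subsetCochains.resH (N := realCoeff.{u}) hsub' n (subsetCochains.resH (N := realCoeff.{u}) hsub n w) = w := by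
      intro w
      rw [← ModuleCat.comp_apply, ← HomologicalComplex.homologyMap_comp, ← subsetCochains.res_comp hsub' hsub]
      exact subsetCochains.resH_refl_apply _ n w
    rwa [hrr, hrr] at this
  rw [hfac, hfac] at key
  exact hbij.1 (hinj_res key)

/-- **Transfer in the second factor**: if `Hˡ(↥V; ℝ) = 0` for an open `V ⊆ N`, then the pull-backs
along `id × val : M × ↥V → M × N` of the two sides on `(M, W)` agree (`β|_V` is exact, so both
sides for the second factor `↥V` vanish). [cite: Bredon1993, Thm. V.9.5] -/
theorem pullH_lhs_eq_pullH_rhs_of_opens_snd (V : TopologicalSpace.Opens N) [Subsingleton (singularCohomology ℝ ℝ ↥V l)]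
    {W : Set M} (hW : IsOpen W) (β : closedSmoothForms I' N ℝ l) (h : k + l = n)
    (a : (localDeRhamComplex I ℝ hW).homology k) :
    subsetCochains.pullH (N := realCoeff.{u})
        (idProdMapCM (M := M) (contMDiff_subtype_val : ContMDiff I' I' ∞ (Subtype.val : ↥V → N)))
        (mapsTo_id_prodMap (Subtype.val : ↥V → N) W) n (lhs N hW β k n h a) =
      subsetCochains.pullH (N := realCoeff.{u})
        (idProdMapCM (M := M) (contMDiff_subtype_val : ContMDiff I' I' ∞ (Subtype.val : ↥V → N)))
        (mapsTo_id_prodMap (Subtype.val : ↥V → N) W) n (rhs N hW β k n h a) := by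
  haveI : LocallyCompactSpace ↥V := V.isOpen.locallyCompactSpace
  rw [← lhs_pullbackPair_snd (contMDiff_subtype_val : ContMDiff I' I' ∞ (Subtype.val : ↥V → N)) hW β h a,
    ← rhs_pullbackPair_snd (contMDiff_subtype_val : ContMDiff I' I' ∞ (Subtype.val : ↥V → N)) hW β h a]
  exact lhs_eq_rhs_of_subsingleton_snd hW _ h a

end Transfer

end Literature.Geometry.Manifold
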